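import Summits.Ventures.CertifiedArithmetic.Expansions.CompressStaircaseFixedPoint
import Summits.Ventures.CertifiedArithmetic.Expansions.CompressFixedPointChain

/-!
# The fixed points of COMPRESS are exactly the chains (packaging)

New work of the certified-arithmetic venture (ENGINES group: shared numerical engines serving
client cells; rigour lives in the verifiers; every published number belongs to a client cell's
ledger, not to the engines group).

`CompressStaircaseFixedPoint` proved that a CHAIN — every component a nonzero float absorbed by
the next, `fl(eᵢ₊₁ + eᵢ) = eᵢ₊₁` — is left unchanged by COMPRESS [Shewchuk1997, §2.7
Theorem 23];
`CompressFixedPointChain` proved the converse for nonoverlapping expansions of floats under any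
round-to-nearest.  THIS FILE states the equivalence (`compress_eq_self_iff_isChain`) and its
reading for a SECOND PASS: `COMPRESS(COMPRESS(e)) = COMPRESS(e)` exactly when the first output is
a chain (`compress_compress_eq_iff`).  HONEST FRAMING: a structural fact about the printed
algorithm; Theorem 23 claims neither idempotence nor minimality.
-/

namespace Summit.Ventures.CertifiedArithmetic.Expansions

open Literature.ComputerArithmetic.JeannerodRump2018
open Literature.ComputerArithmetic.BoldoJeannerodMelquiondMuller2023 hiding twoSum twoSum_fst
open Literature.ComputerArithmetic.Shewchuk1997

variable {p : ℕ} {emin : ℤ}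

/-- **Fixed points of COMPRESS = chains** (any round-to-nearest, `p ≥ 2`, nonoverlapping
expansions of floats). [cite: Shewchuk1997, Thm 23 p. 331–333] -/
theorem compress_eq_self_iff_isChain {fl : ℚ → ℚ} (hp : 2 ≤ p)
    (hfl : IsRoundNearest p emin fl) {e : List ℚ} (he : ∀ x ∈ e, IsFloat p emin x)
    (hexp : IsExpansion 1 e) :
    compress fl e = e ↔ List.IsChain (fun a b => fl (b + a) = b ∧ fl a = a ∧ a ≠ 0) e :=
  ⟨compress_fixed_isChain hp hfl he hexp,
    compress_eq_self_of_isChain (fl_eq_self hfl (isFloat_zero p emin))⟩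

/-- **Second pass**: `COMPRESS(COMPRESS(e)) = COMPRESS(e)` iff the first output is a chain — the
output of Theorem 23 is again a nonoverlapping expansion of floats, so the equivalence applies to
it. [cite: Shewchuk1997, Thm 23 p. 331] -/
theorem compress_compress_eq_iff {fl : ℚ → ℚ} (hp : 2 ≤ p) (hfl : IsRoundNearest p emin fl)
    {e : List ℚ} (he : ∀ x ∈ e, IsFloat p emin x) (hexp : IsExpansion 1 e) :
    compress fl (compress fl e) = compress fl e ↔
      List.IsChain (fun a b => fl (b + a) = b ∧ fl a = a ∧ a ≠ 0) (compress fl e) :=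
  have out := compress_nonoverlapping hp hfl he hexp
  compress_eq_self_iff_isChain hp hfl out.floats out.exp

end Summit.Ventures.CertifiedArithmetic.Expansions
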